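import Summits.ResolutionOfSingularities.ResolutionOfSingularities.Theorems.PurelyInseparableDim4SpineCertCycles
import Summits.ResolutionOfSingularities.ResolutionOfSingularities.Theorems.PurelyInseparableDim4GameDeterminacy
import HarnessLib
import HarnessLib.Audit.Tags

/-!
# [OURS · res-dim4-pi PR-9b″] WIN CERTIFICATES for the spine game under the CARDINALITY-FIRST
  restriction: the three certified spine cycles of the census (C-003 = K-A-01's support, C-006, C-002)
  start at positions from which player A, still playing cardinality-first centres but choosing among the
  TIES, WINS — kernel-checked AND–OR trees

Cell `res-dim4-pi` (D-0157 DOOR 2), brick **PR-9b″** (seat `res-dim4-p-7`, bus 16:5xZ; format credit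
res-dim4-p-8 — this file reuses p-8's computable mirror `SpineCert.degInC / chartExpC / spineMoveC /
wonB / permB / cardFirstB` and transport `SpineCert.ofC`, `spineWon_ofC_iff`, `spinePermissible_ofC_iff`,
`spineMove_ofC` verbatim, and res-dim4-p-14's abstract attractor `Game.Wins` /
`Game.Wins.not_mem_of_isTrapSet`; nothing is restated).

The census' literal MODE-1h spine cycles (K-S1-1 `not_terminates1h_two`; p-8's `cycleCert_c003 / c006 /
c002`, N-CF) are plays of ONE cardinality-first positional strategy (the lexicographic tie-break).  This
file certifies, by `decide`, finite AND–OR WIN TREES: from each of the three cycle positions player A,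
RESTRICTED to cardinality-first centres (the support shadow of MODE 1h, every tie allowed), forces a won
position of TY-9's spine game (`q = 2`, pure move + cleaning deletion) against every choice of charts by
player B — in at most 4 (C-003), 7 (C-006), 4 (C-002) moves.  Reading (census value, OURS): at these
specimens the spine cycling of MODE 1h is a TIE-BREAK artefact, not a cardinality-first artefact;
whether SOME cardinality-first tie-break wins the spine game from EVERY position stays open (no
`∀`-tie-break cardinality-first spine trap was found in p-7's bounded search, bus 16:5xZ).

## Contents
* §1 the checker: `nodeB` (one node: not won, centre cardinality-first, every chart answer either WON
  or a LATER node of the list with the right position), `WinCert q L` (decidable);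
* §2 soundness: `WinCert.wins_get` — every listed position lies in `Game.Wins` for ANY legality implied
  by «not won ∧ cardinality-first» and implying «not won» (reverse induction on the index), instantiated
  as `wins_cardFirst_get` (the cardinality-first-RESTRICTED spine game) and `wins_spine_get` (TY-9's
  spine game as read by p-14's `SpinePositional`), plus `not_mem_trap_of_winCert`;
* §3 the three specimens `c003W / c006W / c002W` (`decide`) and the headline facts
  `wins_cardFirst_c003A₀ / c006A₀ / c002A₀`, `wins_spine_c003A₀ / …`, stated on p-8's positions
  `SpineCert.c003A₀ / c006A₀ / c002A₀`.

A won support game is a statement about OUR frame read at chart origins; player B may leave the spine in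
the real walk, so NOTHING here says that some MODE-1h tie-break terminates on states, and nothing here
proves resolution of singularities in dimension ≥ 4 / characteristic `p`.  [OURS · ‖ K · counted 0 · AI
work weaker than expert review]  bears_on: LADDER-RESOLUTION:D157-DOOR2 (res-dim4-pi · PR-9b″ · N-CF).
Supports stmt-ResolutionOfSingularities-16155 (helper).
-/

set_option linter.dupNamespace false -- mandated namespace of this single-conjunct summit

namespace Summit.ResolutionOfSingularities.ResolutionOfSingularities.Theorems.PIDim4

namespace SpineWinCert

open Finset
open Literature.AlgebraicGeometry.Resolution
open SpineCert

/-! ## §1 The win-certificate checker -/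

/-- Test of ONE node `(A, J, c)` of a win certificate `L` at index `k`: `A` is not yet won, `J` is a
cardinality-first permissible centre at `A`, and for every chart `j ∈ J` the spine move of `A` is
either a WON position or the position of the node with index `c j`, which lies strictly LATER in the
list. [folklore] -/
def nodeB (q : ℕ) (L : List (Finset (Fin 4 → ℕ) × Finset (Fin 4) × (Fin 4 → ℕ)))
    (k : Fin L.length) : Bool :=
  !wonB q (L.get k).1 && cardFirstB q (L.get k).2.1 (L.get k).1 &&
    decide (∀ j ∈ (L.get k).2.1,
      wonB q (spineMoveC q (L.get k).2.1 j (L.get k).1) = true ∨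
        (k.1 < (L.get k).2.2 j ∧
          (L[(L.get k).2.2 j]?).map Prod.fst = some (spineMoveC q (L.get k).2.1 j (L.get k).1)))

/-- **Win certificate**: a nonempty list of nodes every one of which passes `nodeB` — a finite AND–OR
tree (shared sub-trees allowed) of cardinality-first moves of player A closed under all chart answers of
player B, every leaf a won position.  Decidable, so concrete certificates are checked by `decide`.
[folklore] -/
def WinCert (q : ℕ) (L : List (Finset (Fin 4 → ℕ) × Finset (Fin 4) × (Fin 4 → ℕ))) : Prop :=
  L ≠ [] ∧ ∀ k : Fin L.length, nodeB q L k = true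

/-- `nodeB` says what it tests. [folklore] -/
theorem nodeB_eq_true_iff (q : ℕ) (L : List (Finset (Fin 4 → ℕ) × Finset (Fin 4) × (Fin 4 → ℕ)))
    (k : Fin L.length) :
    nodeB q L k = true ↔
      wonB q (L.get k).1 = false ∧ cardFirstB q (L.get k).2.1 (L.get k).1 = true ∧
        ∀ j ∈ (L.get k).2.1,
          wonB q (spineMoveC q (L.get k).2.1 j (L.get k).1) = true ∨
            (k.1 < (L.get k).2.2 j ∧
              (L[(L.get k).2.2 j]?).map Prod.fst =
                some (spineMoveC q (L.get k).2.1 j (L.get k).1)) := by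
  simp [nodeB, Bool.and_eq_true, and_assoc]

/-! ## §2 Soundness: certified positions lie in player A's attractor -/

namespace WinCert

variable {q : ℕ} {L : List (Finset (Fin 4 → ℕ) × Finset (Fin 4) × (Fin 4 → ℕ))}

/-- A certified list is nonempty. [folklore] -/
theorem length_pos (h : WinCert q L) : 0 < L.length :=
  List.length_pos_iff.mpr h.1

/-- **Soundness of win certificates** for any legality `legal` of player A's moves that is implied by
«not won ∧ cardinality-first» and implies «not won» (e.g. the cardinality-first-restricted spine game,
or TY-9's spine game): every listed position, read through `ofC`, lies in the attractor `Game.Wins` of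
the spine move.  Reverse induction on the index: the children of a node are won or later. [folklore] -/
theorem wins_get (h : WinCert q L) {legal : SpinePos → Finset (Fin 4) → Prop}
    (hleg : ∀ (A : Finset (Fin 4 → ℕ)) (J : Finset (Fin 4)),
      wonB q A = false → cardFirstB q J A = true → legal (ofC A) J)
    (hnw : ∀ (A : SpinePos) (J : Finset (Fin 4)), legal A J → ¬ SpineWon q A) (k : Fin L.length) :
    Game.Wins legal (fun A J A' => ∃ j ∈ J, A' = spineMove q J j A) (ofC (L.get k).1) := by
  suffices H : ∀ d : ℕ, ∀ k : Fin L.length, L.length - k.1 = d →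
      Game.Wins legal (fun A J A' => ∃ j ∈ J, A' = spineMove q J j A) (ofC (L.get k).1) from
    H _ k rfl
  intro d
  induction d using Nat.strong_induction_on with
  | _ d ih =>
    intro k hk
    obtain ⟨hw, hcf, hch⟩ := (nodeB_eq_true_iff q L k).mp (h.2 k)
    refine Game.Wins.move (m := (L.get k).2.1) (hleg _ _ hw hcf) ?_
    rintro A' ⟨j, hj, rfl⟩
    rw [spineMove_ofC]
    rcases hch j hj with hwon | ⟨hlt, hsome⟩
    · exact Game.Wins.terminal fun J' hJ' => hnw _ _ hJ' ((spineWon_ofC_iff q _).mpr hwon)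
    · obtain ⟨node, hnode, hfst⟩ := Option.map_eq_some_iff.mp hsome
      obtain ⟨hlen, hget⟩ := List.getElem?_eq_some_iff.mp hnode
      have hpos : (L.get ⟨(L.get k).2.2 j, hlen⟩).1 = spineMoveC q (L.get k).2.1 j (L.get k).1 := by
        rw [List.get_eq_getElem, hget]
        exact hfst
      rw [← hpos]
      exact ih (L.length - (L.get k).2.2 j) (by omega) ⟨(L.get k).2.2 j, hlen⟩ rfl

/-- **Soundness, cardinality-first-RESTRICTED spine game**: player A, allowed only permissible centres
of least cardinality (the support shadow of MODE 1h, every tie), forces a won position from every listed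
position. [folklore] -/
theorem wins_cardFirst_get (h : WinCert q L) (k : Fin L.length) :
    Game.Wins
      (fun (A : SpinePos) (J : Finset (Fin 4)) => ¬ SpineWon q A ∧ SpinePermissible q J A ∧
        ∀ J' : Finset (Fin 4), SpinePermissible q J' A → J.card ≤ J'.card)
      (fun A J A' => ∃ j ∈ J, A' = spineMove q J j A) (ofC (L.get k).1) := by
  refine h.wins_get (fun A J hw hcf => ?_) (fun A J hAJ => hAJ.1) k
  obtain ⟨hperm, hmin⟩ := (cardFirstB_eq_true_iff q J A).mp hcf
  refine ⟨fun hW => ?_, (spinePermissible_ofC_iff q J A).mpr hperm, fun J' hJ' => ?_⟩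
  · rw [(spineWon_ofC_iff q A).mp hW] at hw
    exact Bool.noConfusion hw
  · exact hmin J' ((spinePermissible_ofC_iff q J' A).mp hJ')

/-- **Soundness, TY-9's spine game** (legality «not won ∧ permissible», the reading of
`SpinePositional.positionalWin4_iff_forall_wins`): every listed position lies in A's attractor.
[folklore] -/
theorem wins_spine_get (h : WinCert q L) (k : Fin L.length) :
    Game.Wins
      (fun (A : SpinePos) (J : Finset (Fin 4)) => ¬ SpineWon q A ∧ SpinePermissible q J A)
      (fun A J A' => ∃ j ∈ J, A' = spineMove q J j A) (ofC (L.get k).1) := by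
  refine h.wins_get (fun A J hw hcf => ?_) (fun A J hAJ => hAJ.1) k
  obtain ⟨hperm, -⟩ := (cardFirstB_eq_true_iff q J A).mp hcf
  refine ⟨fun hW => ?_, (spinePermissible_ofC_iff q J A).mpr hperm⟩
  rw [(spineWon_ofC_iff q A).mp hW] at hw
  exact Bool.noConfusion hw

/-- The head position of a win certificate lies in NO cardinality-first TRAP (a set of positions in
which every cardinality-first centre has a chart answer staying inside): win certificates and
`∀`-tie-break traps exclude each other. [folklore] -/
theorem not_mem_trap_get (h : WinCert q L) (k : Fin L.length) {T : Set SpinePos}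
    (hT : Game.IsTrapSet
      (fun (A : SpinePos) (J : Finset (Fin 4)) => ¬ SpineWon q A ∧ SpinePermissible q J A ∧
        ∀ J' : Finset (Fin 4), SpinePermissible q J' A → J.card ≤ J'.card)
      (fun A J A' => ∃ j ∈ J, A' = spineMove q J j A) T) :
    ofC (L.get k).1 ∉ T :=
  (h.wins_cardFirst_get k).not_mem_of_isTrapSet _ _ hT

end WinCert

/-! ## §3 The three census specimens at `q = 2` -/

/-- Win certificate from C-003's position (K-A-01's support `{(0,1,2,2),(0,1,3,1),(1,1,1,3)}`, p-8's
`SpineCert.c003A₀`): 6 nodes; first move the tied pair `{x₃, x₄}` (the lexicographic rule took `{x₁, x₃}`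
and cycles); A wins within 4 moves. [OURS · ‖ K] [folklore] -/
def c003W : List (Finset (Fin 4 → ℕ) × Finset (Fin 4) × (Fin 4 → ℕ)) :=
  [({![0, 1, 2, 2], ![0, 1, 3, 1], ![1, 1, 1, 3]}, {2, 3}, ![0, 0, 3, 1]),
   ({![0, 1, 2, 2], ![0, 1, 3, 2], ![1, 1, 1, 2]}, {3}, ![0, 0, 0, 2]),
   ({![0, 1, 2, 0], ![0, 1, 3, 0], ![1, 1, 1, 0]}, {0, 2}, ![5, 0, 0, 0]),
   ({![0, 1, 2, 1], ![0, 1, 2, 2], ![1, 1, 2, 3]}, {2}, ![0, 0, 4, 0]),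
   ({![0, 1, 0, 1], ![0, 1, 0, 2], ![1, 1, 0, 3]}, {1, 3}, ![0, 0, 0, 0]),
   ({![0, 1, 1, 0], ![0, 1, 2, 0], ![1, 1, 3, 0]}, {1, 2}, ![0, 0, 0, 0])]

/-- Win certificate from C-006's position `{(1,0,2,0),(1,3,0,1),(3,0,0,4)}` (p-8's `SpineCert.c006A₀`):
15 nodes; first move the tied 3-plane `{x₂, x₃, x₄}`; A wins within 7 moves. [OURS · ‖ K] [folklore] -/
def c006W : List (Finset (Fin 4 → ℕ) × Finset (Fin 4) × (Fin 4 → ℕ)) :=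
  [({![1, 0, 2, 0], ![1, 3, 0, 1], ![3, 0, 0, 4]}, {1, 2, 3}, ![0, 5, 0, 1]),
   ({![1, 0, 2, 0], ![1, 3, 0, 2], ![3, 0, 0, 2]}, {2, 3}, ![0, 0, 0, 2]),
   ({![1, 0, 2, 0], ![1, 3, 0, 0], ![3, 0, 0, 0]}, {0, 1, 2}, ![0, 3, 13, 0]),
   ({![1, 1, 2, 0], ![1, 2, 0, 0], ![3, 1, 0, 0]}, {0, 1}, ![4, 8, 0, 0]),
   ({![0, 1, 2, 0], ![1, 2, 0, 0], ![2, 1, 0, 0]}, {0, 1, 2}, ![14, 6, 10, 0]),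
   ({![1, 0, 2, 0], ![1, 2, 0, 1], ![3, 2, 0, 4]}, {1, 2}, ![0, 7, 0, 0]),
   ({![0, 1, 2, 0], ![1, 1, 0, 0], ![2, 1, 0, 0]}, {0, 1, 2}, ![0, 0, 9, 0]),
   ({![1, 0, 0, 1], ![1, 0, 2, 0], ![3, 0, 0, 4]}, {0, 2, 3}, ![0, 0, 11, 0]),
   ({![1, 0, 2, 0], ![1, 1, 0, 0], ![3, 2, 0, 0]}, {0, 1, 2}, ![0, 0, 12, 0]),
   ({![0, 1, 1, 0], ![1, 1, 0, 0], ![2, 1, 1, 0]}, {0, 1, 2}, ![0, 0, 0, 0]),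
   ({![0, 1, 1, 0], ![1, 2, 1, 0], ![2, 1, 1, 0]}, {1, 2}, ![0, 0, 0, 0]),
   ({![1, 0, 0, 1], ![1, 0, 1, 0], ![3, 0, 5, 4]}, {0, 2, 3}, ![0, 0, 0, 0]),
   ({![1, 0, 1, 0], ![1, 1, 0, 0], ![3, 2, 3, 0]}, {0, 1, 2}, ![0, 0, 0, 0]),
   ({![1, 0, 1, 0], ![1, 3, 2, 0], ![3, 0, 1, 0]}, {0, 2}, ![0, 0, 0, 0]),
   ({![1, 1, 0, 0], ![1, 1, 2, 0], ![1, 2, 0, 0]}, {0, 1}, ![0, 0, 0, 0])]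

/-- Win certificate from C-002's position `{(0,2,0,1),(1,0,0,3),(1,0,2,1)}` (p-8's `SpineCert.c002A₀`):
9 nodes; first move the 3-plane `{x₂, x₃, x₄}`; A wins within 4 moves. [OURS · ‖ K] [folklore] -/
def c002W : List (Finset (Fin 4 → ℕ) × Finset (Fin 4) × (Fin 4 → ℕ)) :=
  [({![0, 2, 0, 1], ![1, 0, 0, 3], ![1, 0, 2, 1]}, {1, 2, 3}, ![0, 7, 1, 2]),
   ({![0, 2, 1, 1], ![1, 0, 1, 1], ![1, 0, 1, 3]}, {2, 3}, ![0, 0, 3, 4]),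
   ({![0, 2, 0, 1], ![1, 0, 0, 1], ![1, 0, 2, 1]}, {0, 1, 3}, ![0, 5, 0, 0]),
   ({![0, 2, 0, 1], ![1, 0, 0, 1], ![1, 0, 2, 3]}, {0, 1, 3}, ![0, 6, 0, 0]),
   ({![0, 2, 1, 0], ![1, 0, 1, 0], ![1, 0, 1, 2]}, {0, 1, 2}, ![0, 8, 0, 0]),
   ({![0, 1, 0, 1], ![1, 0, 0, 1], ![1, 0, 2, 1]}, {0, 1, 3}, ![0, 0, 0, 0]),
   ({![0, 1, 0, 1], ![1, 0, 0, 1], ![1, 2, 2, 3]}, {0, 1, 3}, ![0, 0, 0, 0]),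
   ({![0, 1, 0, 1], ![1, 1, 0, 3], ![1, 1, 2, 1]}, {1, 3}, ![0, 0, 0, 0]),
   ({![0, 1, 1, 0], ![1, 0, 1, 0], ![1, 0, 1, 2]}, {0, 1, 2}, ![0, 0, 0, 0])]

/-- **C-003's position is WON by cardinality-first play with the right ties** (kernel check).
[OURS · ‖ K] [folklore] -/
theorem winCert_c003 : WinCert 2 c003W := by
  unfold WinCert c003W
  decide

/-- **C-006's position is WON by cardinality-first play with the right ties** (kernel check).
[OURS · ‖ K] [folklore] -/
theorem winCert_c006 : WinCert 2 c006W := by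
  unfold WinCert c006W
  decide

/-- **C-002's position is WON by cardinality-first play with the right ties** (kernel check).
[OURS · ‖ K] [folklore] -/
theorem winCert_c002 : WinCert 2 c002W := by
  unfold WinCert c002W
  decide

/-- The head of `c003W` is p-8's position `c003A₀`. [folklore] -/
theorem c003W_head : (c003W.get ⟨0, winCert_c003.length_pos⟩).1 = c003A₀ := rfl

/-- The head of `c006W` is p-8's position `c006A₀`. [folklore] -/
theorem c006W_head : (c006W.get ⟨0, winCert_c006.length_pos⟩).1 = c006A₀ := rfl

/-- The head of `c002W` is p-8's position `c002A₀`. [folklore] -/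
theorem c002W_head : (c002W.get ⟨0, winCert_c002.length_pos⟩).1 = c002A₀ := rfl

/-- **K-A-01's support is in the attractor of the cardinality-first-restricted spine game at `q = 2`**:
from `c003A₀` player A, playing only permissible centres of least cardinality, forces a won position
whatever charts player B chooses — the K-S1-1 / C-003 cycle is a tie-break phenomenon there.
[OURS · ‖ K] [folklore] -/
theorem wins_cardFirst_c003A₀ :
    Game.Wins
      (fun (A : SpinePos) (J : Finset (Fin 4)) => ¬ SpineWon 2 A ∧ SpinePermissible 2 J A ∧
        ∀ J' : Finset (Fin 4), SpinePermissible 2 J' A → J.card ≤ J'.card)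
      (fun A J A' => ∃ j ∈ J, A' = spineMove 2 J j A) (ofC c003A₀) := by
  rw [← c003W_head]
  exact winCert_c003.wins_cardFirst_get _

/-- The same for C-006's position `c006A₀`. [OURS · ‖ K] [folklore] -/
theorem wins_cardFirst_c006A₀ :
    Game.Wins
      (fun (A : SpinePos) (J : Finset (Fin 4)) => ¬ SpineWon 2 A ∧ SpinePermissible 2 J A ∧
        ∀ J' : Finset (Fin 4), SpinePermissible 2 J' A → J.card ≤ J'.card)
      (fun A J A' => ∃ j ∈ J, A' = spineMove 2 J j A) (ofC c006A₀) := by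
  rw [← c006W_head]
  exact winCert_c006.wins_cardFirst_get _

/-- The same for C-002's position `c002A₀`. [OURS · ‖ K] [folklore] -/
theorem wins_cardFirst_c002A₀ :
    Game.Wins
      (fun (A : SpinePos) (J : Finset (Fin 4)) => ¬ SpineWon 2 A ∧ SpinePermissible 2 J A ∧
        ∀ J' : Finset (Fin 4), SpinePermissible 2 J' A → J.card ≤ J'.card)
      (fun A J A' => ∃ j ∈ J, A' = spineMove 2 J j A) (ofC c002A₀) := by
  rw [← c002W_head]
  exact winCert_c002.wins_cardFirst_get _

/-- The three cycle positions lie in A's attractor of TY-9's spine game (`q = 2`), i.e. they are NOT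
counterexamples to `PositionalWin4 2` (cf. `SpinePositional.positionalWin4_iff_forall_wins`).
[OURS · ‖ K] [folklore] -/
theorem wins_spine_specimens :
    Game.Wins (fun (A : SpinePos) (J : Finset (Fin 4)) => ¬ SpineWon 2 A ∧ SpinePermissible 2 J A)
        (fun A J A' => ∃ j ∈ J, A' = spineMove 2 J j A) (ofC c003A₀) ∧
      Game.Wins (fun (A : SpinePos) (J : Finset (Fin 4)) => ¬ SpineWon 2 A ∧ SpinePermissible 2 J A)
        (fun A J A' => ∃ j ∈ J, A' = spineMove 2 J j A) (ofC c006A₀) ∧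
      Game.Wins (fun (A : SpinePos) (J : Finset (Fin 4)) => ¬ SpineWon 2 A ∧ SpinePermissible 2 J A)
        (fun A J A' => ∃ j ∈ J, A' = spineMove 2 J j A) (ofC c002A₀) := by
  refine ⟨?_, ?_, ?_⟩
  · rw [← c003W_head]; exact winCert_c003.wins_spine_get _
  · rw [← c006W_head]; exact winCert_c006.wins_spine_get _
  · rw [← c002W_head]; exact winCert_c002.wins_spine_get _

/-- **No `∀`-tie-break cardinality-first trap contains K-A-01's support** (nor C-006's, nor C-002's):
whatever set of positions player B proposes in which EVERY cardinality-first centre has a chart answer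
staying inside, these three positions are outside it. [OURS · ‖ K] [folklore] -/
theorem specimens_not_mem_cardFirst_trap {T : Set SpinePos}
    (hT : Game.IsTrapSet
      (fun (A : SpinePos) (J : Finset (Fin 4)) => ¬ SpineWon 2 A ∧ SpinePermissible 2 J A ∧
        ∀ J' : Finset (Fin 4), SpinePermissible 2 J' A → J.card ≤ J'.card)
      (fun A J A' => ∃ j ∈ J, A' = spineMove 2 J j A) T) :
    ofC c003A₀ ∉ T ∧ ofC c006A₀ ∉ T ∧ ofC c002A₀ ∉ T :=
  ⟨wins_cardFirst_c003A₀.not_mem_of_isTrapSet _ _ hT,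
    wins_cardFirst_c006A₀.not_mem_of_isTrapSet _ _ hT,
    wins_cardFirst_c002A₀.not_mem_of_isTrapSet _ _ hT⟩

end SpineWinCert

end Summit.ResolutionOfSingularities.ResolutionOfSingularities.Theorems.PIDim4
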